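import Summits.BirchSwinnertonDyer.BirchSwinnertonDyer.Theorems.CongruentShaFreeCutKatoZetaRoadFactsCensus
import Summits.BirchSwinnertonDyer.BirchSwinnertonDyer.Theorems.CongruentShaFreeCutBDPWaldspurgerFormula
import HarnessLib

set_option linter.dupNamespace false -- `Summit.BirchSwinnertonDyer.BirchSwinnertonDyer.Theorems.…` (summit = sub)
set_option autoImplicit false

/-!
# Route `CongruentShaFreeCut` (rung S2) — KERNEL CENSUS of the KATO–ZETA road to crux B with ONE NAMED
# `Prop` PER RESEARCH INPUT: `crux B ⟸ RI9 ∧ (LB-exist♯) ∧ BDPWaldspurgerFormulaUpTo 2 ∧ (ERL♯)`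

Cell `bsd-cn100`, prover seat `bsd-cn100-s2-c3` (g10). Supports, does not close,
stmt-BirchSwinnertonDyer-19080 (`AnalyticRankOneOfRankOneFiniteShaTwo`, registered line `kato-zeta-perrin-riou`
v1e: `stub_refereedInputs` (9 conjuncts) ∧ `stub_prFormulaAtTwo : PRFormulaAtTwoH2`). THEOREMS ONLY; imports no
`Theses` module directly. The S2 kato-zeta twin of transfer g11's BDP-road census
`CongruentShaFreeCutBDPWaldspurgerCensus.cruxB_of_exists_of_waldspurger_of_wan` (p490840): there the third research
input is the divisibility (LB-wan♯); here it is the Kato ↔ BDP reciprocity (ERL♯)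
(`CongruentShaFreeCutKatoBDPReciprocityUpTo.TwoAdicKatoBDPReciprocityUpTo`, p486660). PARTITION: none — RANK axis.
HONEST FRAMING: conditional compositions over OPEN statements ((LB-exist♯) = a construction of the ♯-BDP element of
`E_n` at the additive prime `2`; `BDPWaldspurgerFormulaUpTo 2` = the generalised `2`-adic Waldspurger formula at
`2 ∣ N`; (ERL♯)); nothing about crux B, the leaf, the congruent number problem or BSD is proved.

* `prFormulaAtTwoH2_of_existsUpTo_of_waldspurger_of_reciprocity` — the registered research stub
  `PRFormulaAtTwoH2` ⟸ {(LB-exist♯), `BDPWaldspurgerFormulaUpTo 2`, (ERL♯)} — each ONE named `Prop`;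
* `cruxB_of_refereedInputs_of_existsUpTo_of_waldspurger_of_reciprocity` — crux B ⟸ the registered 9-conjunct
  bundle `stub_refereedInputs` (token for token) ∧ the same three named Props;
* `cruxB_of_namedFacts_of_existsUpTo_of_waldspurger_of_reciprocity` — the fully displayed form (nine named facts,
  of which `nonempty_iwasawaH2Data` / `thm12_4` / `finite_descentCokernel_of_rankOne` are reading-grade Kato
  statements, + the three research Props).

So the research content of ITEM 19080 on either road reads, modulo citation-borne inputs, as THREE named Props:
existence (LB-exist♯) and value (`BDPWaldspurgerFormulaUpTo 2`) — shared with the BDP road and with crux A's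
line on stmt-19079 — and ONE of {(ERL♯) [this road], (LB-wan♯) [BDP road]}.

References: [AlpogeBhargavaShnidman2022] App. A Thm. 10.8 (a); [BertoliniDarmonVenerucci2022] Thm. A (shape,
semistable odd p); [BertoliniDarmonPrasanna2013] Thm. 5.13 (shape); [Kato2004Asterisque] Thm. 12.4, §14.14.
Shapes only; nothing asserted.
-/

noncomputable section

open scoped Classical

open WeierstrassCurve NumberField IsDedekindDomain Field Literature.NumberTheory.EllipticCurves
  Literature.NumberTheory.EllipticCurves.ModularForms
  Literature.NumberTheory.EllipticCurves.Kato2004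
  Literature.NumberTheory.GaloisRepresentations
  Summit.BirchSwinnertonDyer.BirchSwinnertonDyer.Theses.CongruentShaFreeCut
  Summit.BirchSwinnertonDyer.BirchSwinnertonDyer.Theorems.CongruentShaFreeCutKatoZetaRoadPinnedH2
open Summit.BirchSwinnertonDyer.BirchSwinnertonDyer.Theorems.CongruentShaFreeCutTwoAdicBDPTripleUpTo
  (TwoAdicBDPElementExistsUpTo)
open Summit.BirchSwinnertonDyer.BirchSwinnertonDyer.Theorems.CongruentShaFreeCutTwoAdicBDPExistsValueUpTo
  (TwoAdicBDPElementExistsWithValueUpTo)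
open Summit.BirchSwinnertonDyer.BirchSwinnertonDyer.Theorems.CongruentShaFreeCutKatoBDPReciprocityUpTo
  (TwoAdicKatoBDPReciprocityUpTo prFormulaAtTwoH2_of_bdpExistsValueUpTo_of_reciprocity)
open Summit.BirchSwinnertonDyer.BirchSwinnertonDyer.Theorems.CongruentShaFreeCutBDPWaldspurgerFormula
  (BDPWaldspurgerFormulaUpTo bdpExistsWithValueUpTo_of_exists_of_waldspurger)
open Summit.BirchSwinnertonDyer.BirchSwinnertonDyer.Theorems.CongruentShaFreeCutKatoZetaRoadFactsCensus
  (cruxB_of_namedFacts_of_prFormulaH2 cruxB_of_refereedInputs_of_prFormulaH2)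

namespace Summit.BirchSwinnertonDyer.BirchSwinnertonDyer.Theorems.CongruentShaFreeCutKatoZetaRoadNamedPropsCensus

/-- **The registered research stub `PRFormulaAtTwoH2` from THREE named Props**: the existence half (LB-exist♯)
`TwoAdicBDPElementExistsUpTo`, the value half `BDPWaldspurgerFormulaUpTo 2`, and the reciprocity (ERL♯)
`TwoAdicKatoBDPReciprocityUpTo` (= `prFormulaAtTwoH2_of_bdpExistsValueUpTo_of_reciprocity` ∘
`bdpExistsWithValueUpTo_of_exists_of_waldspurger`). CONDITIONAL; closes nothing.
[cite: AlpogeBhargavaShnidman2022, App. A Thm. 10.8 (a) (p. 33) (shape)]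
[cite: BertoliniDarmonPrasanna2013, Thm. 5.13 (shape; p ∤ N there)] -/
theorem prFormulaAtTwoH2_of_existsUpTo_of_waldspurger_of_reciprocity (hE : TwoAdicBDPElementExistsUpTo)
    (hW : BDPWaldspurgerFormulaUpTo 2) (hERL : TwoAdicKatoBDPReciprocityUpTo) : PRFormulaAtTwoH2 :=
  prFormulaAtTwoH2_of_bdpExistsValueUpTo_of_reciprocity (bdpExistsWithValueUpTo_of_exists_of_waldspurger hE hW)
    hERL

/-- **Crux B ⟸ the registered 9-conjunct bundle `stub_refereedInputs` (token for token) ∧ (LB-exist♯) ∧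
`BDPWaldspurgerFormulaUpTo 2` ∧ (ERL♯)** — the kato-zeta road's end state with one named `Prop` per research
input. CONDITIONAL; closes nothing. [cite: AlpogeBhargavaShnidman2022, App. A Thm. 10.1 and §10.1.3 (pp. 33–34)]
[cite: Kato2004Asterisque, Thm. 12.4 (p. 221) and §14.14 (p. 243)] -/
theorem cruxB_of_refereedInputs_of_existsUpTo_of_waldspurger_of_reciprocity
    (RI : (∀ (W : WeierstrassCurve ℚ) [W.IsElliptic] (p : ℕ) [Fact p.Prime], p_parity W p) ∧
      ModularForms.exists_isNewformOf ∧
      HoffsteinLuo1997_exists_twist_L_one_ne_zero ∧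
      (∀ (W : WeierstrassCurve ℚ) [W.IsElliptic] (p : ℕ) [Fact p.Prime],
        kato_finite_of_L_one_ne_zero W p) ∧
      (∀ (W : WeierstrassCurve ℚ) (K : Type) [Field K] [NumberField K], exists_isHeegnerPoint W K) ∧
      (∀ (W : WeierstrassCurve ℚ) (N : ℕ) [NeZero N] (K : Type) [Field K] [NumberField K],
        analyticRankEK_eq_one_iff_heegner_nonTorsion W N K) ∧
      nonempty_iwasawaH2Data ∧ thm12_4 ∧ finite_descentCokernel_of_rankOne)
    (hE : TwoAdicBDPElementExistsUpTo) (hW : BDPWaldspurgerFormulaUpTo 2)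
    (hERL : TwoAdicKatoBDPReciprocityUpTo) :
    AnalyticRankOneOfRankOneFiniteShaTwo :=
  cruxB_of_refereedInputs_of_prFormulaH2 RI
    (prFormulaAtTwoH2_of_existsUpTo_of_waldspurger_of_reciprocity hE hW hERL)

/-- **Crux B from NINE NAMED FACTS and THREE NAMED RESEARCH PROPS** (fully displayed): six refereed theorems
(`2`-parity, modularity, Hoffstein–Luo, Kato finiteness, Heegner points, Gross–Zagier + Kolyvagin), three
reading-grade typed Kato statements, and {(LB-exist♯), `BDPWaldspurgerFormulaUpTo 2`, (ERL♯)}. CONDITIONAL;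
closes nothing. [cite: AlpogeBhargavaShnidman2022, App. A Thm. 10.1 and §10.1.3 (pp. 33–34)]
[cite: Kato2004Asterisque, Thm. 12.4 (p. 221), (14.9.3) (p. 240), §14.14 (p. 243)] -/
theorem cruxB_of_namedFacts_of_existsUpTo_of_waldspurger_of_reciprocity
    (hpar : ∀ (W : WeierstrassCurve ℚ) [W.IsElliptic] (p : ℕ) [Fact p.Prime], p_parity W p)
    (hmod : ModularForms.exists_isNewformOf) (hHL : HoffsteinLuo1997_exists_twist_L_one_ne_zero)
    (hKato : ∀ (W : WeierstrassCurve ℚ) [W.IsElliptic] (p : ℕ) [Fact p.Prime],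
      kato_finite_of_L_one_ne_zero W p)
    (hHP : ∀ (W : WeierstrassCurve ℚ) (K : Type) [Field K] [NumberField K],
      exists_isHeegnerPoint W K)
    (hGZ : ∀ (W : WeierstrassCurve ℚ) (N : ℕ) [NeZero N] (K : Type) [Field K] [NumberField K],
      analyticRankEK_eq_one_iff_heegner_nonTorsion W N K)
    (h2 : nonempty_iwasawaH2Data) (h12 : thm12_4) (h31 : finite_descentCokernel_of_rankOne)
    (hE : TwoAdicBDPElementExistsUpTo) (hW : BDPWaldspurgerFormulaUpTo 2)
    (hERL : TwoAdicKatoBDPReciprocityUpTo) :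
    AnalyticRankOneOfRankOneFiniteShaTwo :=
  cruxB_of_namedFacts_of_prFormulaH2 hpar hmod hHL hKato hHP hGZ h2 h12 h31
    (prFormulaAtTwoH2_of_existsUpTo_of_waldspurger_of_reciprocity hE hW hERL)

end Summit.BirchSwinnertonDyer.BirchSwinnertonDyer.Theorems.CongruentShaFreeCutKatoZetaRoadNamedPropsCensus

end
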